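import Summits.ResolutionOfSingularities.ResolutionOfSingularities.Theorems.WeakOrderReduction
import Literature.AlgebraicGeometry.Resolution.HironakaDirectrix
import Literature.AlgebraicGeometry.Resolution.HironakaTauScheme
import Literature.AlgebraicGeometry.Resolution.Blowups
import Literature.AlgebraicGeometry.Resolution.MarkedIdeals
import Mathlib.FieldTheory.IsAlgClosed.AlgebraicClosure
import HarnessLib

/-!
# FaceFormCutClasses — the dimension-four core cut by the FACE FORM of a hyperplanar top point
(decomp-res node N50 «FaceFormCut», lens-2 g9; route-independent part, phase 1)

Source HOME/decomp-res-lens-2/g9/FaceFormCut.lean (sha256 c1beb67c77f16f90, 451 lines; critic `lean check` rc 0,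
0 sorry, `closes_core` axioms standard), CRITIC-LEDGER row 60 (2026-08-30T08:48Z): CLEARED (MAP +1, DECIDED PIECE
+1, residual/strata 0).  Parent BY NAME on the route: `MaxContactCut.RungOne` (29273, `E 2 → E 1`; marking-`n` slice
`WeakOrderReduction.SeqDimFour 1 n`); edges to 28544 and 30461 in the kernels file.

THE NEW PARAMETER.  At a CORE top point `y` of order `n ≥ 2` (`τ = 1`, contact-free) every order-`n` element is
`f = zⁿ + G(c)` with `G` a form of degree `n + 1` in a regular system of parameters `c = (z, c₁, …, c_d)`; its FACE
FORM is `Φ := Ḡ(0, Y₁, …, Y_d)`, the degree-`(n+1)` initial form of `f mod z` on `P(Dir_y) ≅ ℙ^{d-1}` (polyhedron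
language: `δ = 1 + 1/n` is minimal iff `Φ ≠ 0`, and then `in_δ(f) = Zⁿ + Φ`).  ENGINE `FaceFormExit` (typed below,
paper proof = the Rees-chart computation `f′ = wⁿ + t·g′`: a near point `x′` over `y` lies on `P(Dir_y)` with
`mult_{x′} Φ ≥ n − 1`, and at `n = 2` a regular point of `{Φ = 0}` is a near point with `in₂ = W² + TU + …`, so
`τ(x′) ≥ 3`; characteristic-free, every residue field, every dimension; port L, prover target #19): if `Φ` has NO
geometric point of multiplicity `≥ max(2, n − 1)` («generic face», open dense) then for `n ≥ 3` no point over `y`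
is near and for `n = 2` every near point has class ≥ 2 — the point is absorbed by `E 2` after ONE blow-up.

THE CUT (EXACT, pure logic, PROVED): `SeqDimFour 1 n ⟺ SeqGen n ∧ SeqSpec n` (`seqDimFour_one_iff`) — all top points
of class ≥ 2 or closed-isolated FACE-GENERIC, versus SOME face-special core top point; `SeqSpec n ⟺ SeqSpecDeep n ∧
SeqSpecCritical n` (`seqSpec_iff`: `Φ = 0`, «δ > 1 + 1/n», kangaroo / Moh specimens, versus `Φ ≠ 0` degenerate,
CossartPiltant2019 Rem. 3.2 / Giraud quadrics); `GenericRung := E 2 → ∀ n ≥ 1, SeqGen n` is DECIDED-MOD-PORT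
(`genericRung_of_engine` from `FaceFormExit` + the bookkeeping port `OneShotPort n` + `OrderOneContact`);
`SpecialRung := E 2 → ∀ n ≥ 1, SeqSpec n` is THE LOCATED RESIDUAL (UNDECIDED · IDEA-NEEDED · cofinal, score 0).
Tags: `GenericRung` WEAKER · DECIDED-MOD-PORT (+1, transverse to FedderCut: the Fermat cubic `z² + x³ + y³ + t³`,
`p = 2`, is impure and face-generic); `SpecialRung` residual 0; `SeqSpecDeep` / `SeqSpecCritical` UNDECIDED ·
INSTRUMENTABLE; ports `FaceFormExit` (L), `OneShotPort` (M), `OrderOneContact` (S) COSTUME/DECIDED.  The rung-level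
statements are asides of `Theses/MaxContactCut.lean` refining 29273; by-name kernels (`RungOne ⟺ GenericRung ∧
SpecialRung`, edges to 28544 / 30461) live in `Theorems/MaxContactCutFaceFormCut.lean`.
(Sources: CossartPiltant2008 proof of Prop. 4.2, Lemma 4.3; Hironaka1970 Thm 2; CossartJannsenSaito2020 (δ,
polyhedra); CossartPiltant2019 Rem. 3.2; Giraud1975; BenitoVillamayor2012; BierstoneGrigorievMilmanWlodarczyk2011
§3.1.)
-/

open CategoryTheory AlgebraicGeometry TopologicalSpace IsLocalRing
open Literature.AlgebraicGeometry.Resolution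
open Summit.ResolutionOfSingularities.ResolutionOfSingularities.Theorems
open Summit.ResolutionOfSingularities.ResolutionOfSingularities.Theorems.WeakOrderReduction

namespace Summit.ResolutionOfSingularities.ResolutionOfSingularities.Theorems.FaceFormCutClasses

/-! ## §1  Forms: geometric multiplicity below a threshold; non-degenerate face forms -/

/-- `MultLT P v m`: the multiplicity of the polynomial `P` at the vector `v` is `< m` — some monomial of total
degree `< m` survives in the Taylor translate `P(Y + v)`.  (Characteristic-free; equivalent to the non-vanishing at
`v` of some Hasse derivative of order `< m`.)  DEFINITION (support). -/
def MultLT {K : Type} [Field K] {d : ℕ} (P : MvPolynomial (Fin d) K) (v : Fin d → K) (m : ℕ) : Prop :=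
  ∃ α ∈ (MvPolynomial.aeval (fun i => MvPolynomial.X i + MvPolynomial.C (v i)) P).support,
    (α.sum fun _ e => e) < m

/-- The threshold `max(2, n − 1)`: `n − 1` from the near-point inequality (a), raised to `2` at `n = 2` where (b)
needs the face hypersurface to be regular at the near point.  DEFINITION (support). -/
def faceThreshold (n : ℕ) : ℕ := max 2 (n - 1)

/-- **GENERIC FACE FORM.**  `Φ ∈ K[Y₀, …, Y_d]` (a form not involving `Y₀`, read on the hyperplane `{Y₀ = 0}`) has
NO geometric point of multiplicity `≥ m`: at every non-zero vector `v` over the algebraic closure with `v₀ = 0` the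
multiplicity of `Φ` is `< m`.  For `m = 2`: `{Φ = 0} ⊂ ℙ^{d-1}` is smooth; in general an OPEN DENSE condition on
forms of degree `n+1` (complement of codimension `C(n+d-3, d-1) − (d-1) ≥ 1` for `m = max(2, n-1)`).  DEFINITION
(support). -/
def FaceGeneric {K : Type} [Field K] {d : ℕ} (Φ : MvPolynomial (Fin (d + 1)) K) (m : ℕ) : Prop :=
  ∀ v : Fin (d + 1) → AlgebraicClosure K, v ≠ 0 → v 0 = 0 →
    MultLT (MvPolynomial.map (algebraMap K (AlgebraicClosure K)) Φ) v m

/-- Killing the directrix variable `Y₀`: `G ↦ G(0, Y₁, …, Y_d)`.  DEFINITION (support). -/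
noncomputable def killZero {K : Type} [CommRing K] {d : ℕ} :
    MvPolynomial (Fin (d + 1)) K →ₐ[K] MvPolynomial (Fin (d + 1)) K :=
  MvPolynomial.aeval (Fin.cases (0 : MvPolynomial (Fin (d + 1)) K) fun i => MvPolynomial.X i.succ)

/-- **`HasGenericFace c J n`** (ring level, `R` local with residue field `k`, `c = (c₀ = z, c₁, …, c_d)` generators of
`𝔪`): `J` contains an element `zⁿ + G(c)` with `G` a form of degree `n + 1` over `R` whose FACE FORM
`Φ = Ḡ(0, Y₁, …, Y_d)` is generic at threshold `max(2, n − 1)`.  DEFINITION (support; typed over the tree's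
`initialForms` conventions of `Literature…HironakaDirectrix`). (Sources: CossartJannsenSaito2020 (δ-initial form).) -/
def HasGenericFace {R : Type} [CommRing R] [IsLocalRing R] {d : ℕ} (c : Fin (d + 1) → R) (J : Ideal R) (n : ℕ) :
    Prop :=
  ∃ G : MvPolynomial (Fin (d + 1)) R, G.IsHomogeneous (n + 1) ∧ c 0 ^ n + MvPolynomial.eval c G ∈ J ∧
    FaceGeneric (killZero (MvPolynomial.map (residue R) G)) (faceThreshold n)

/-- **`HasDeepFace c J n`** («δ > 1 + 1/n», face ABSENT): `J ∋ zⁿ + G(c)` with `G` a form of degree `n + 1` whose face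
form vanishes: `Ḡ(0, Y₁, …, Y_d) = 0`, i.e. `f ≡ zⁿ (mod z·𝔪ⁿ + 𝔪^{n+2})`.  DEFINITION (support). -/
def HasDeepFace {R : Type} [CommRing R] [IsLocalRing R] {d : ℕ} (c : Fin (d + 1) → R) (J : Ideal R) (n : ℕ) :
    Prop :=
  ∃ G : MvPolynomial (Fin (d + 1)) R, G.IsHomogeneous (n + 1) ∧ c 0 ^ n + MvPolynomial.eval c G ∈ J ∧
    killZero (MvPolynomial.map (residue R) G) = 0

/-! ## §2  The engine's output predicate and the ENGINE -/

/-- **EXIT at `y` (w.r.t. the generators `c` of `𝔪_y`)**: for every blow-up `π : Y′ → Y` whose centre `Z` has stalk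
ideal `(c) = 𝔪_y` at `y` (the point `y` is an isolated reduced point of the centre), every point `x′` over `y` that
is NEAR for `(J, n)` (tree `IsNear`: `ord_{x′}` of the controlled transform `= n`) has `n = 2` and `τ(x′) ≥ 3` (tree
`stalkTau` of the controlled transform).  In particular for `n ≥ 3` NO point over `y` is near.  DEFINITION (support,
the conclusion shape of the engine; tree notions `IsBlowup`, `IsNear`, `controlledTransform`, `stalkTau`). (Sources:
CossartPiltant2008 Lemma 4.3.) -/
def ExitsAt {Y : Scheme.{0}} (J : Y.IdealSheafData) (n : ℕ) (y : Y) {d : ℕ} (c : Fin (d + 1) → Y.presheaf.stalk y) :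
    Prop :=
  ∀ (Y' : Scheme.{0}) (π : Y' ⟶ Y) (Z : Closeds Y), IsBlowup π (Scheme.IdealSheafData.vanishingIdeal Z) →
    IsLocallyNoetherian Y → IsLocallyNoetherian Y' →
    Ideal.span (Set.range c) = stalkIdeal (Scheme.IdealSheafData.vanishingIdeal Z) y →
    ∀ x' : Y', π x' = y → ∀ _ : IsRegularLocalRing (Y'.presheaf.stalk x'),
      IsNear π (Scheme.IdealSheafData.vanishingIdeal Z) J n x' →
        n = 2 ∧ 3 ≤ stalkTau (controlledTransform π (Scheme.IdealSheafData.vanishingIdeal Z) J n) x' n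

/-- **ENGINE `FaceFormExit`** [DECIDED · paper proof in the module docstring ((a) near points over `y` lie on
`P(Dir_y)` with `mult Φ ≥ n − 1`; (b) at `n = 2`, a regular point of the face hypersurface is a near point with `in₂
= W² + TU + …`, `τ ≥ 3`) · characteristic-free, EVERY residue field, EVERY dimension · port L: the Rees-chart
computation `f′ = wⁿ + t·g′` over the tree's `IsBlowup.exists_reesChart_stalk` / `initialForms` apparatus (the `r =
3`, `τ = 3` sibling is the tree theorem `IsBlowup.not_isNear_of_stalkTau_eq_three`, CossartPiltant2008 Lemma 4.3
(1))]: at a point `y` of a scheme with regular local ring `𝒪_{Y,y}` and a REGULAR SYSTEM OF PARAMETERS `c` (`(c) =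
𝔪_y`, minimal: `d + 1 = embdim` — without minimality a padded zero parameter could fake a generic face), a generic
face at order `n ≥ 2` forces EXIT. STATEMENT (engine). (Sources: CossartPiltant2008 proof of Prop. 4.2, Lemma 4.3;
Hironaka1970 Thm 2; CossartJannsenSaito2020.) -/
def FaceFormExit : Prop :=
  ∀ (Y : Scheme.{0}) (J : Y.IdealSheafData) (n : ℕ), 2 ≤ n → ∀ (y : Y), ∀ _ : IsRegularLocalRing (Y.presheaf.stalk y),
    ∀ (d : ℕ) (c : Fin (d + 1) → Y.presheaf.stalk y), Ideal.span (Set.range c) = maximalIdeal (Y.presheaf.stalk y) →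
      (maximalIdeal (Y.presheaf.stalk y)).spanFinrank = d + 1 →
      HasGenericFace c (stalkIdeal J y) n → ExitsAt J n y c

/-! ## §3  Pointwise classes at a top point of dimension-four data -/

/-- `y` is ISOLATED in the top locus `{ord = n}` of `I`.  DEFINITION (support). -/
def IsIsolatedTop {Y : Scheme.{0}} (I : Y.IdealSheafData) (n : ℕ) (y : Y) : Prop :=
  ∃ U : Y.Opens, y ∈ U ∧ ∀ y' : Y, y' ∈ U → idealOrder I y' = ((n : ℕ) : ℕ∞) → y' = y

/-- **FACE-GENERIC top point**: closed, isolated in the top locus, and `I_y` has a generic face at order `n` in some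
regular system of parameters (at a contact-free `τ = 1` point the directrix direction `c₀` is forced).
DEFINITION (support). -/
def IsFaceGenericPt {Y : Scheme.{0}} (I : Y.IdealSheafData) (n : ℕ) (y : Y) : Prop :=
  IsClosed ({y} : Set Y) ∧ IsIsolatedTop I n y ∧
    ∃ (d : ℕ) (c : Fin (d + 1) → Y.presheaf.stalk y),
      Ideal.span (Set.range c) = maximalIdeal (Y.presheaf.stalk y) ∧
        (maximalIdeal (Y.presheaf.stalk y)).spanFinrank = d + 1 ∧ HasGenericFace c (stalkIdeal I y) n

/-- **DEEP-FACE point** («δ > 1 + 1/n»): some `zⁿ + g ∈ I_y` has vanishing face form.  DEFINITION (support). -/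
def IsDeepFacePt {Y : Scheme.{0}} (I : Y.IdealSheafData) (n : ℕ) (y : Y) : Prop :=
  ∃ (d : ℕ) (c : Fin (d + 1) → Y.presheaf.stalk y),
    Ideal.span (Set.range c) = maximalIdeal (Y.presheaf.stalk y) ∧
      (maximalIdeal (Y.presheaf.stalk y)).spanFinrank = d + 1 ∧ HasDeepFace c (stalkIdeal I y) n

/-- **EXIT point**: closed, isolated in the top locus, with the engine's exit property in some generators of `𝔪_y`.
DEFINITION (support; the hypothesis shape of the bookkeeping port). -/
def IsExitPt {Y : Scheme.{0}} (I : Y.IdealSheafData) (n : ℕ) (y : Y) : Prop :=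
  IsClosed ({y} : Set Y) ∧ IsIsolatedTop I n y ∧
    ∃ (d : ℕ) (c : Fin (d + 1) → Y.presheaf.stalk y),
      Ideal.span (Set.range c) = maximalIdeal (Y.presheaf.stalk y) ∧
        (maximalIdeal (Y.presheaf.stalk y)).spanFinrank = d + 1 ∧ ExitsAt I n y c

/-- **FACE-SPECIAL core point** (the located class): a top point that is NOT of class ≥ 2 (contact-free with `τ = 1`)
and NOT face-generic.  DEFINITION (support). -/
def IsFaceSpecialPt {k : Type} [Field k] {Y : Scheme.{0}} (g : Y ⟶ Spec (.of k)) (hY : Scheme.IsRegular Y)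
    (I : Y.IdealSheafData) (n : ℕ) (y : Y) : Prop :=
  ¬ ClassGE g hY I n 2 y ∧ ¬ IsFaceGenericPt I n y

/-! ## §4  The graded statements (fresh-data frame = the binders of `WeakOrderReduction.SeqDimFour`) -/

/-- **`SeqGen n`** — weak order reduction in dimension four at marking `n` for data ALL of whose top points are of
class ≥ 2 or FACE-GENERIC.  [DECIDED-MOD-PORT relative to `SeqDimFour 2 n`: kernel `genRungAt_of_engine`.]
STATEMENT SCHEMA. (Sources: BierstoneGrigorievMilmanWlodarczyk2011 §3.1; CossartJannsenSaito2020.) -/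
def SeqGen (n : ℕ) : Prop :=
  ∀ p : ℕ, p.Prime → ∀ (k : Type) [Field k] [CharP k p]
    (Y : Scheme.{0}) (g : Y ⟶ Spec (.of k)), IsSeparated g → LocallyOfFiniteType g → QuasiCompact g →
    ∀ hY : Scheme.IsRegular Y, topologicalKrullDim Y ≤ 4 →
    ∀ I : Y.IdealSheafData, (∀ y : Y, idealOrder I y ≤ ((n : ℕ) : ℕ∞)) →
      (∀ y : Y, idealOrder I y = ((n : ℕ) : ℕ∞) → ClassGE g hY I n 2 y ∨ IsFaceGenericPt I n y) →
      ∃ t : CentreSeq Y, WeakResolution t (⟨I, [], n⟩ : MarkedIdeal Y)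

/-- **`SeqSpec n`** — THE LOCATED CLASS: weak order reduction in dimension four at marking `n` for data having a
FACE-SPECIAL core top point.  [UNDECIDED · IDEA-NEEDED · cofinal in the core.]  STATEMENT SCHEMA. (Sources:
BierstoneGrigorievMilmanWlodarczyk2011 §3.1; CossartJannsenSaito2020.) -/
def SeqSpec (n : ℕ) : Prop :=
  ∀ p : ℕ, p.Prime → ∀ (k : Type) [Field k] [CharP k p]
    (Y : Scheme.{0}) (g : Y ⟶ Spec (.of k)), IsSeparated g → LocallyOfFiniteType g → QuasiCompact g →
    ∀ hY : Scheme.IsRegular Y, topologicalKrullDim Y ≤ 4 →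
    ∀ I : Y.IdealSheafData, (∀ y : Y, idealOrder I y ≤ ((n : ℕ) : ℕ∞)) →
      (∃ y : Y, idealOrder I y = ((n : ℕ) : ℕ∞) ∧ IsFaceSpecialPt g hY I n y) →
      ∃ t : CentreSeq Y, WeakResolution t (⟨I, [], n⟩ : MarkedIdeal Y)

/-- `SeqSpecDeep n` — the DEEP stratum of the located class: some face-special core top point is deep-faced (`Φ =
0`, «δ > 1 + 1/n»; bed: kangaroo / Moh / weighted-quotient / Hauser–Perlega cylinders).  [UNDECIDED.] (Sources:
Hironaka1970; CossartJannsenSaito2020.) -/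
def SeqSpecDeep (n : ℕ) : Prop :=
  ∀ p : ℕ, p.Prime → ∀ (k : Type) [Field k] [CharP k p]
    (Y : Scheme.{0}) (g : Y ⟶ Spec (.of k)), IsSeparated g → LocallyOfFiniteType g → QuasiCompact g →
    ∀ hY : Scheme.IsRegular Y, topologicalKrullDim Y ≤ 4 →
    ∀ I : Y.IdealSheafData, (∀ y : Y, idealOrder I y ≤ ((n : ℕ) : ℕ∞)) →
      (∃ y : Y, idealOrder I y = ((n : ℕ) : ℕ∞) ∧ IsFaceSpecialPt g hY I n y ∧ IsDeepFacePt I n y) →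
      ∃ t : CentreSeq Y, WeakResolution t (⟨I, [], n⟩ : MarkedIdeal Y)

/-- `SeqSpecCritical n` — the CRITICAL stratum: face-special core top points exist and NONE of them is deep-faced
(`δ`-minimal with degenerate face form; bed: CossartPiltant2019 Rem. 3.2 `Z^p + u₄u₁^p + u₃u₂^p`, Giraud's quadric,
umbrella-pinch and cusp-umbrella cylinders).  [UNDECIDED · INSTRUMENTABLE T-face-strata.] (Sources:
CossartPiltant2019 Rem. 3.2; Giraud1975.) -/
def SeqSpecCritical (n : ℕ) : Prop :=
  ∀ p : ℕ, p.Prime → ∀ (k : Type) [Field k] [CharP k p]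
    (Y : Scheme.{0}) (g : Y ⟶ Spec (.of k)), IsSeparated g → LocallyOfFiniteType g → QuasiCompact g →
    ∀ hY : Scheme.IsRegular Y, topologicalKrullDim Y ≤ 4 →
    ∀ I : Y.IdealSheafData, (∀ y : Y, idealOrder I y ≤ ((n : ℕ) : ℕ∞)) →
      (∃ y : Y, idealOrder I y = ((n : ℕ) : ℕ∞) ∧ IsFaceSpecialPt g hY I n y) →
      (∀ y : Y, idealOrder I y = ((n : ℕ) : ℕ∞) → IsFaceSpecialPt g hY I n y → ¬ IsDeepFacePt I n y) →
      ∃ t : CentreSeq Y, WeakResolution t (⟨I, [], n⟩ : MarkedIdeal Y)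

/-- **`OneShotPort n`** [COSTUME(M) · engine-free bookkeeping]: if every top point of a dim-4 datum is of class ≥ 2
or an EXIT point, then `SeqDimFour 2 n` already yields a weak resolution — blow up the finitely many (isolated ⇒
irreducible components of the noetherian top locus) exit points one after the other (each reduced closed point is a
regular centre inside the support: a weakly admissible `CentreSeq` prefix; its vanishing ideal has stalk `𝔪_y` at
`y`; the blow-up of a regular scheme at a closed point is regular and locally noetherian); off the centres orders
and classes are unchanged (`IsBlowup.idealOrder_controlledTransform_eq_of_not_mem_support`), over them every near
point has class ≥ 2 by EXIT, and `ord ≤ n` persists (CoP1 Prop. 4.2 (a)); apply `SeqDimFour 2 n` to the transformed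
FRESH datum and concatenate.  STATEMENT (port). (Sources: BierstoneGrigorievMilmanWlodarczyk2011 Def. 3.1.3;
CossartPiltant2008 Prop. 4.2.) -/
def OneShotPort (n : ℕ) : Prop :=
  SeqDimFour 2 n →
  ∀ p : ℕ, p.Prime → ∀ (k : Type) [Field k] [CharP k p]
    (Y : Scheme.{0}) (g : Y ⟶ Spec (.of k)), IsSeparated g → LocallyOfFiniteType g → QuasiCompact g →
    ∀ hY : Scheme.IsRegular Y, topologicalKrullDim Y ≤ 4 →
    ∀ I : Y.IdealSheafData, (∀ y : Y, idealOrder I y ≤ ((n : ℕ) : ℕ∞)) →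
      (∀ y : Y, idealOrder I y = ((n : ℕ) : ℕ∞) → ClassGE g hY I n 2 y ∨ IsExitPt I n y) →
      ∃ t : CentreSeq Y, WeakResolution t (⟨I, [], n⟩ : MarkedIdeal Y)

/-- **`OrderOneContact`** [COSTUME(S)]: a point of order exactly `1` is a contact point (`Diff^{≤0}(I) = I` contains
a germ in `𝔪 ∖ 𝔪²`), so at marking `1` every top point is of class ≥ 2.  STATEMENT (port). (Sources: Giraud1975;
folklore.) -/
def OrderOneContact : Prop :=
  ∀ p : ℕ, p.Prime → ∀ (k : Type) [Field k] [CharP k p]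
    (Y : Scheme.{0}) (g : Y ⟶ Spec (.of k)), IsSeparated g → LocallyOfFiniteType g → QuasiCompact g →
    Scheme.IsRegular Y → ∀ I : Y.IdealSheafData, ∀ y : Y, idealOrder I y = ((1 : ℕ) : ℕ∞) → IsContactPt g I 1 y

/-- `GenRungAt n` — the generic rung at one marking: `SeqDimFour 2 n → SeqGen n`.  [DECIDED-MOD-PORT, `n ≥ 2`:
`genRungAt_of_engine`; `n = 1`: `genRungAt_one`.] -/
def GenRungAt (n : ℕ) : Prop := SeqDimFour 2 n → SeqGen n

/-- **`GenericRung`** — the GENERIC half of `RungOne`: `E 2 →` weak order reduction for every marking and all data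
whose core top points are face-generic.  [DECIDED-MOD-PORT(M): `genericRung_of_engine`.]  STATEMENT (decided piece).
(Sources: CossartPiltant2008 Prop. 4.2.) -/
def GenericRung : Prop := E 2 → ∀ n : ℕ, 1 ≤ n → SeqGen n

/-- **`SpecialRung`** — the SPECIAL half of `RungOne` = THE LOCATED RESIDUAL of this node: `E 2 →` weak order
reduction for every marking and all data with a face-special core top point.  [UNDECIDED · IDEA-NEEDED · cofinal ⇒
score 0.] STATEMENT (located residual). (Sources: CossartPiltant2019 Rem. 3.2; Giraud1975.) -/
def SpecialRung : Prop := E 2 → ∀ n : ℕ, 1 ≤ n → SeqSpec n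

/-! ## §5  Kernels — pure logic (0 sorry) -/

section Kernels

variable {n : ℕ}

/-- Pointwise trichotomy → dichotomy: a top point is of class ≥ 2, or face-generic, or face-special. [folklore] -/
theorem classGE_or_generic_or_special {k : Type} [Field k] {Y : Scheme.{0}} (g : Y ⟶ Spec (.of k))
    (hY : Scheme.IsRegular Y) (I : Y.IdealSheafData) (n : ℕ) (y : Y) :
    (ClassGE g hY I n 2 y ∨ IsFaceGenericPt I n y) ∨ IsFaceSpecialPt g hY I n y := by
  by_cases h1 : ClassGE g hY I n 2 y
  · exact Or.inl (Or.inl h1)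
  by_cases h2 : IsFaceGenericPt I n y
  · exact Or.inl (Or.inr h2)
  · exact Or.inr ⟨h1, h2⟩

/-- **EXACT at each marking**: `SeqDimFour 1 n ⟺ SeqGen n ∧ SeqSpec n` (excluded middle on «some top point is
face-special»). [folklore] -/
theorem seqDimFour_one_iff : SeqDimFour 1 n ↔ SeqGen n ∧ SeqSpec n := by
  constructor
  · intro h
    refine ⟨?_, ?_⟩
    · intro p hp k _ _ Y g h1 h2 h3 hY h4 I hord _
      exact h p hp k Y g h1 h2 h3 hY h4 I hord (fun y _ => Or.inl le_rfl)
    · intro p hp k _ _ Y g h1 h2 h3 hY h4 I hord _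
      exact h p hp k Y g h1 h2 h3 hY h4 I hord (fun y _ => Or.inl le_rfl)
  · rintro ⟨hG, hS⟩ p hp k _ _ Y g h1 h2 h3 hY h4 I hord _
    by_cases hex : ∃ y : Y, idealOrder I y = ((n : ℕ) : ℕ∞) ∧ IsFaceSpecialPt g hY I n y
    · exact hS p hp k Y g h1 h2 h3 hY h4 I hord hex
    · refine hG p hp k Y g h1 h2 h3 hY h4 I hord ?_
      intro y hy
      rcases classGE_or_generic_or_special g hY I n y with h | h
      · exact h
      · exact absurd ⟨y, hy, h⟩ hex

/-- **EXACT sub-cut of the located class**: `SeqSpec n ⟺ SeqSpecDeep n ∧ SeqSpecCritical n` (excluded middle on «some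
face-special top point is deep-faced»). [folklore] -/
theorem seqSpec_iff : SeqSpec n ↔ SeqSpecDeep n ∧ SeqSpecCritical n := by
  constructor
  · intro h
    refine ⟨?_, ?_⟩
    · intro p hp k _ _ Y g h1 h2 h3 hY h4 I hord hex
      obtain ⟨y, hy, hs, -⟩ := hex
      exact h p hp k Y g h1 h2 h3 hY h4 I hord ⟨y, hy, hs⟩
    · intro p hp k _ _ Y g h1 h2 h3 hY h4 I hord hex _
      exact h p hp k Y g h1 h2 h3 hY h4 I hord hex
  · rintro ⟨hD, hC⟩ p hp k _ _ Y g h1 h2 h3 hY h4 I hord hex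
    by_cases hdeep : ∃ y : Y, idealOrder I y = ((n : ℕ) : ℕ∞) ∧ IsFaceSpecialPt g hY I n y ∧ IsDeepFacePt I n y
    · exact hD p hp k Y g h1 h2 h3 hY h4 I hord hdeep
    · refine hC p hp k Y g h1 h2 h3 hY h4 I hord hex ?_
      intro y hy hs hd
      exact hdeep ⟨y, hy, hs, hd⟩

/-- The two classes at one marking give all data (the `mpr` direction, by name for probes and ports). [folklore] -/
theorem seqDimFour_one_of_gen_spec (hG : SeqGen n) (hS : SeqSpec n) : SeqDimFour 1 n :=
  seqDimFour_one_iff.mpr ⟨hG, hS⟩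

/-- `SeqGen n` is `SeqDimFour 1 n` restricted: weaker BY LETTER. [folklore] -/
theorem seqGen_of_seqDimFour_one (h : SeqDimFour 1 n) : SeqGen n := (seqDimFour_one_iff.mp h).1

/-- `SeqSpec n` is `SeqDimFour 1 n` restricted: weaker BY LETTER. [folklore] -/
theorem seqSpec_of_seqDimFour_one (h : SeqDimFour 1 n) : SeqSpec n := (seqDimFour_one_iff.mp h).2

/-- `SeqDimFour 2 n` is `SeqGen n` restricted (no face-generic points at all): the generic piece sits BETWEEN the two
rungs, `SeqDimFour 1 n ⇒ SeqGen n ⇒ SeqDimFour 2 n`. [folklore] -/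
theorem seqDimFour_two_of_seqGen (h : SeqGen n) : SeqDimFour 2 n := by
  intro p hp k _ _ Y g h1 h2 h3 hY h4 I hord hcls
  exact h p hp k Y g h1 h2 h3 hY h4 I hord (fun y hy => Or.inl (hcls y hy))

/-- **THE ENGINE AT WORK (pure logic given the two typed pieces)**: `FaceFormExit` turns every face-generic top point
into an EXIT point, and the engine-free port `OneShotPort n` does the bookkeeping: `GenRungAt n` for `n ≥ 2`.
[folklore] -/
theorem genRungAt_of_engine (hE : FaceFormExit) (hP : OneShotPort n) (hn : 2 ≤ n) : GenRungAt n := by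
  intro h2 p hp k _ _ Y g hg1 hg2 hg3 hY h4 I hord hcls
  refine hP h2 p hp k Y g hg1 hg2 hg3 hY h4 I hord ?_
  intro y hy
  rcases hcls y hy with h | ⟨hcl, hiso, d, c, hc, hfr, hface⟩
  · exact Or.inl h
  · exact Or.inr ⟨hcl, hiso, d, c, hc, hfr, hE Y I n hn y (hY y) d c hc hfr hface⟩

/-- At marking `1` every top point is a contact point (port `OrderOneContact`), hence of class ≥ 2: `GenRungAt 1` with
no blow-up at all. [folklore] -/
theorem genRungAt_one (h1 : OrderOneContact) : GenRungAt 1 := by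
  intro h2 p hp k _ _ Y g hg1 hg2 hg3 hY h4 I hord _
  refine h2 p hp k Y g hg1 hg2 hg3 hY h4 I hord ?_
  intro y hy
  exact Or.inr (Or.inl (h1 p hp k Y g hg1 hg2 hg3 hY I y hy))

/-- **`GenericRung` is DECIDED modulo the typed pieces**: the engine, the bookkeeping port at every marking `≥ 2`, and
the order-one contact port. [folklore] -/
theorem genericRung_of_engine (hE : FaceFormExit) (hP : ∀ n : ℕ, 2 ≤ n → OneShotPort n) (h1 : OrderOneContact) :
    GenericRung := by
  intro hE2 n hn
  by_cases h : 2 ≤ n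
  · exact genRungAt_of_engine hE (hP n h) h (hE2 n hn)
  · have hn1 : n = 1 := by omega
    subst hn1
    exact genRungAt_one h1 (hE2 1 hn)

/-- `E 1` ⟺ the two families at every marking (EXACT, family level). [folklore] -/
theorem e_one_iff_families : E 1 ↔ (∀ n : ℕ, 1 ≤ n → SeqGen n) ∧ (∀ n : ℕ, 1 ≤ n → SeqSpec n) :=
  ⟨fun h => ⟨fun n hn => seqGen_of_seqDimFour_one (h n hn), fun n hn => seqSpec_of_seqDimFour_one (h n hn)⟩,
    fun h n hn => seqDimFour_one_iff.mpr ⟨h.1 n hn, h.2 n hn⟩⟩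

/-- The located residual split at the rung: `SpecialRung ⟺ (E 2 → ∀ n, SeqSpecDeep n) ∧ (E 2 → ∀ n, SeqSpecCritical
n)`. [folklore] -/
theorem specialRung_iff_strata : SpecialRung ↔
    (E 2 → ∀ n : ℕ, 1 ≤ n → SeqSpecDeep n) ∧ (E 2 → ∀ n : ℕ, 1 ≤ n → SeqSpecCritical n) :=
  ⟨fun h => ⟨fun hE2 n hn => (seqSpec_iff.mp (h hE2 n hn)).1, fun hE2 n hn => (seqSpec_iff.mp (h hE2 n hn)).2⟩,
    fun h hE2 n hn => seqSpec_iff.mpr ⟨h.1 hE2 n hn, h.2 hE2 n hn⟩⟩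

end Kernels

end Summit.ResolutionOfSingularities.ResolutionOfSingularities.Theorems.FaceFormCutClasses
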